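import Mathlib
import Summits.Ventures.PercRepro2.Defs
import Summits.Ventures.PercRepro2.Independence
import Summits.Ventures.PercRepro2.Harris
import Summits.Ventures.PercRepro2.CoinDefs
import Summits.Ventures.PercRepro2.CoinArcsOff
import Summits.Ventures.PercRepro2.CoinPendantDefs
import Summits.Ventures.PercRepro2.CoinPendant
import Summits.Ventures.PercRepro2.CoinInduced
import Summits.Ventures.PercRepro2.CoinVdBK
import Summits.Ventures.PercRepro2.CoinBHK
import Summits.Ventures.PercRepro2.CoinReverse
import Summits.Ventures.PercRepro2.CoinTwoPendantDefs
import Summits.Ventures.PercRepro2.CoinTwoPendantMass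
import Summits.Ventures.PercRepro2.CoinTraceLevels

/-!
# The tower identity and (AV-PA) of the trace law for a GENERAL pendant set (blind cell
PercRepro2, night-2 g3; proofs/NIGHT2-DARC.md §17)

Single target `t`, pendant set `P` closed out into `{t}` with pendant coins carrying only arcs
with tails in `P ∪ {t}`.  The trace law is `μ_Z = ℓ_Z · P_Z`, `ℓ_Z = P(traceLevel Z)`,
`P_Z = P(R^{D₀}_{Z ∪ {t}})`, `Z ∈ P.powerset`.
* `trace_tower`: for `U ⊆ P` and any `g : Set V → R`,
  `E[g(K⁻ ∩ P); K⁻ avoids {s} ∪ U] = Σ_{Z ⊆ P, Z ∩ U = ∅} g(Z) μ_Z`;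
* `trace_pa` (**(AV-PA) of the trace law in mass form**): for monotone nonnegative `g₁, g₂`,
  `(Σ_{𝒩_U} g₁ μ)(Σ_{𝒩_U} g₂ μ) ≤ (Σ_{𝒩_U} g₁g₂ μ)(Σ_{𝒩_U} μ)` over `𝒩_U = {Z ⊆ P : Z ∩ U = ∅}`
  — `trace_bhk` (directed BHK for `K⁻` in the T-frame) read through the tower.
-/

namespace Summit.Ventures.PercRepro2.Coin

section Tower

open Classical

variable {V : Type*} {E : Type*} [DecidableEq V] {arcs : E → Finset (V × V)} {P : Finset V}

omit [DecidableEq V] in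
/-- On the level `Z` (single target `t`) the trace SET is `↑Z`. -/
lemma traceSet_eq_of_mem_level {t : V} {Z : Finset V} (hZ : Z ⊆ P) {ω : Config E}
    (hlev : ω ∈ traceLevel arcs {t} P Z) :
    {x | Reach arcs ω x t} ∩ (↑P : Set V) = ↑Z := by
  ext x
  simp only [Set.mem_inter_iff, Set.mem_setOf_eq, Finset.mem_coe]
  constructor
  · rintro ⟨hx, hxP⟩
    exact (hlev x hxP).mpr ⟨t, Finset.mem_singleton_self t, hx⟩
  · intro hxZ
    have hxP := hZ hxZ
    obtain ⟨t', ht', hr⟩ := (hlev x hxP).mp hxZ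
    rw [Finset.mem_singleton] at ht'
    subst ht'
    exact ⟨hr, hxP⟩

/-- **The avoidance set of `{s} ∪ U` over the levels**: for `U ⊆ P`,
`{K⁻ avoids {s} ∪ U} = ⊔_{Z ⊆ P, Z ∩ U = ∅} (traceLevel Z ∩ R^{D₀}_{Z ∪ {t}})`. -/
theorem avoidU_eq_biUnion_levels {U : Finset V} (hU : U ⊆ P) (s t : V) :
    {ω : Config E | ∀ x ∈ insert s U, ¬ Reach arcs ω x t} =
      ⋃ Z ∈ P.powerset.filter (fun Z => Disjoint Z U),
        (traceLevel arcs {t} P Z ∩ avoidEvent (arcsOff arcs (P ∪ {t})) s (Z ∪ {t})) := by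
  have hsplit : ∀ ω : Config E, ω ∈ {ω : Config E | ∀ x ∈ insert s U, ¬ Reach arcs ω x t} ↔
      ω ∈ avoidEvent arcs s {t} ∧ ∀ u ∈ U, ¬ Reach arcs ω u t := by
    intro ω
    simp only [Set.mem_setOf_eq, Finset.mem_insert, forall_eq_or_imp, avoidEvent,
      Finset.mem_singleton, forall_eq]
  ext ω
  rw [hsplit, avoid_eq_biUnion_levels arcs s {t} P]
  simp only [Set.mem_iUnion, Set.mem_inter_iff, Finset.mem_powerset, Finset.mem_filter,
    exists_prop]
  constructor
  · rintro ⟨⟨Z, hZ, hlev, hR⟩, hUav⟩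
    refine ⟨Z, ⟨hZ, ?_⟩, hlev, hR⟩
    rw [Finset.disjoint_left]
    intro z hzZ hzU
    obtain ⟨t', ht', hr⟩ := (hlev z (hZ hzZ)).mp hzZ
    rw [Finset.mem_singleton] at ht'
    subst ht'
    exact hUav z hzU hr
  · rintro ⟨Z, ⟨hZ, hdisj⟩, hlev, hR⟩
    refine ⟨⟨Z, hZ, hlev, hR⟩, fun u hu hr => ?_⟩
    have hzZ : u ∈ Z := (hlev u (hU hu)).mpr ⟨t, Finset.mem_singleton_self t, hr⟩
    exact Finset.disjoint_left.mp hdisj hzZ hu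

end Tower

section TowerMass

open Classical

variable {V : Type*} {E : Type*} [DecidableEq V] [Fintype E] [DecidableEq E] {R : Type*} [Field R]

/-- **The tower identity for trace functionals** (general pendant set, single target): for
`U ⊆ P`, `E[g(K⁻ ∩ P); K⁻ avoids {s} ∪ U] = Σ_{Z ⊆ P, Z ∩ U = ∅} g(Z) · ℓ_Z · P_Z`. -/
theorem trace_tower (p : E → R) {arcs : E → Finset (V × V)} {P : Finset V} {t : V}
    (hclosed : ClosedOut arcs P {t}) (hT : TailCoinsIn arcs P {t}) {U : Finset V} (hU : U ⊆ P)
    (s : V) (g : Set V → R) :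
    massE p (fun ω => g ({x | Reach arcs ω x t} ∩ (↑P : Set V)))
        {ω : Config E | ∀ x ∈ insert s U, ¬ Reach arcs ω x t} =
      ∑ Z ∈ P.powerset.filter (fun Z => Disjoint Z U),
        g ↑Z * (prob p (traceLevel arcs {t} P Z) *
          prob p (avoidEvent (arcsOff arcs (P ∪ {t})) s (Z ∪ {t}))) := by
  rw [avoidU_eq_biUnion_levels hU s t, massE_biUnion p _ _ _
    (pairwiseDisjoint_levels (fun Z hZ => Finset.mem_powerset.mp (Finset.mem_filter.mp hZ).1) _)]
  refine Finset.sum_congr rfl fun Z hZ => ?_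
  have hZP : Z ⊆ P := Finset.mem_powerset.mp (Finset.mem_filter.mp hZ).1
  have hconst : DependsOn (fun _ : Config E => g ↑Z) (tailCoins arcs P)ᶜ := fun _ _ _ => rfl
  rw [trace_piece p hT (dependsOn_traceLevel hclosed Z) s _ hconst
    (fun ω hω => by rw [traceSet_eq_of_mem_level hZP hω.1]), massE_const]
  ring

/-- **(AV-PA) of the trace law in mass form** (general pendant set, single target): for `U ⊆ P`
and monotone nonnegative `g₁, g₂ : Set V → R`, with `μ_Z = ℓ_Z · P_Z` and
`𝒩_U = {Z ⊆ P : Z ∩ U = ∅}`, `(Σ_{𝒩_U} g₁ μ)(Σ_{𝒩_U} g₂ μ) ≤ (Σ_{𝒩_U} g₁g₂ μ)(Σ_{𝒩_U} μ)`. -/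
theorem trace_pa [LinearOrder R] [IsStrictOrderedRing R] [Fintype V] (p : E → R)
    (hp : IsProbVec p) {arcs : E → Finset (V × V)} (hS : SameEnds arcs) {P : Finset V} {t : V}
    (hclosed : ClosedOut arcs P {t}) (hT : TailCoinsIn arcs P {t}) {U : Finset V} (hU : U ⊆ P)
    (s : V) {g₁ g₂ : Set V → R} (h₁ : Monotone g₁) (h₂ : Monotone g₂) (h₁0 : ∀ S, 0 ≤ g₁ S)
    (h₂0 : ∀ S, 0 ≤ g₂ S) :
    (∑ Z ∈ P.powerset.filter (fun Z => Disjoint Z U),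
        g₁ ↑Z * (prob p (traceLevel arcs {t} P Z) *
          prob p (avoidEvent (arcsOff arcs (P ∪ {t})) s (Z ∪ {t}))))
      * (∑ Z ∈ P.powerset.filter (fun Z => Disjoint Z U),
        g₂ ↑Z * (prob p (traceLevel arcs {t} P Z) *
          prob p (avoidEvent (arcsOff arcs (P ∪ {t})) s (Z ∪ {t})))) ≤
    (∑ Z ∈ P.powerset.filter (fun Z => Disjoint Z U),
        g₁ ↑Z * g₂ ↑Z * (prob p (traceLevel arcs {t} P Z) *
          prob p (avoidEvent (arcsOff arcs (P ∪ {t})) s (Z ∪ {t}))))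
      * (∑ Z ∈ P.powerset.filter (fun Z => Disjoint Z U),
        prob p (traceLevel arcs {t} P Z) *
          prob p (avoidEvent (arcsOff arcs (P ∪ {t})) s (Z ∪ {t}))) := by
  have h := trace_bhk p hp hS t s U (↑P : Set V) h₁ h₂ h₁0 h₂0
  rw [expect_mul_indicator_one, expect_mul_indicator_one, expect_mul_indicator_one,
    prob_eq_massE_one] at h
  rw [trace_tower p hclosed hT hU s g₁, trace_tower p hclosed hT hU s g₂,
    trace_tower p hclosed hT hU s (fun S => g₁ S * g₂ S),
    trace_tower p hclosed hT hU s (fun _ => 1)] at h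
  simpa only [one_mul] using h

end TowerMass

end Summit.Ventures.PercRepro2.Coin
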